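import Literature.AlgebraicGeometry.ShimuraVarieties.UnitaryAuxiliarySymplecticNondegenerate
import Literature.LinearAlgebra.FreeModule.IntegralFrobeniusFrame
import HarnessLib

/-!
# An integral symplectic frame for the auxiliary symplectic space `(W₀ ⊕ V_M, ψ)`

Deligne's auxiliary construction [cite: Deligne1979ShimuraVarieties, Prop. 2.3.10 (PDF p. 32)]: for the
alternating trace form `ψ = auxForm M j H ξ₀ ξ` on `U = M^{1 ⊕ 3}` (nondegenerate by
`auxForm_nondegenerate`) and ANY `ℚ`-basis `c` of `U` (whose `ℤ`-span is the lattice one wants the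
frame adapted to), some positive multiple `n • ψ = auxForm M j H (n•ξ₀) (n•ξ)` admits a symplectic
frame `β : U ≃ ℚ^{g ⊕ g}` of a polarization type `δ = (d₁ ∣ ⋯ ∣ d_g)` with `β = T ∘ c⁎` for an
integer matrix `T` invertible over `ℤ` — i.e. `β⁻¹(ℤ^{2g})` is exactly the `ℤ`-span of `c`
(Frobenius' elementary divisor theorem, ★ `exists_integral_frobenius_frame`).

Topic `AlgebraicGeometry/ShimuraVarieties`; namespace
`Literature.AlgebraicGeometry.ShimuraVarieties.UnitaryCanonicalModel.Aux`.
-/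

noncomputable section

open Matrix NumberField
open Literature.AlgebraicGeometry.ModuliOfAbelianVarieties Literature.LinearAlgebra.FreeModule

namespace Literature.AlgebraicGeometry.ShimuraVarieties.UnitaryCanonicalModel.Aux

open Literature.NumberTheory.Automorphic Literature.NumberTheory.Automorphic.UnitaryGroup

variable {L : Type} [Field L] [NumberField L] [IsCMField L] {M : Type} [Field M] [NumberField M]
  [IsCMField M] (j : L →+* M) (H : Matrix (Fin 3) (Fin 3) L) (ξ₀ ξ : M)

omit [NumberField L] [IsCMField L] [IsCMField M] in
/-- `auxGram` is `ℚ`-linear in the pair `(ξ₀, ξ)`: `G(aξ₀, aξ) = a • G(ξ₀, ξ)`.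
[cite: Deligne1979ShimuraVarieties, Prop. 2.3.10 (PDF p. 32)] -/
theorem auxGram_smul (a : ℚ) : auxGram M j H (a • ξ₀) (a • ξ) = a • auxGram M j H ξ₀ ξ := by
  unfold auxGram
  rw [Matrix.fromBlocks_smul, smul_zero, smul_zero, smul_assoc, smul_assoc]

omit [NumberField L] [IsCMField L] in
/-- `auxForm` is `ℚ`-linear in the pair `(ξ₀, ξ)`: `ψ_{aξ₀, aξ} = a · ψ_{ξ₀, ξ}`.
[cite: Deligne1979ShimuraVarieties, Prop. 2.3.10 (PDF p. 32)] -/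
theorem auxForm_smul (a : ℚ) (v w : (Fin 1 ⊕ Fin 3) → M) :
    auxForm M j H (a • ξ₀) (a • ξ) v w = a * auxForm M j H ξ₀ ξ v w := by
  rw [auxForm_apply, auxForm_apply, auxGram_smul, Matrix.smul_mulVec, dotProduct_smul, map_smul,
    smul_eq_mul]

/-- Products of integer matrices cast to `ℚ`. [cite: Lang2002, XIII §3] -/
theorem map_intCast_mul {l m n : Type*} [Fintype m] (A : Matrix l m ℤ) (B : Matrix m n ℤ) :
    (A * B).map (Int.cast : ℤ → ℚ) = A.map (Int.cast : ℤ → ℚ) * B.map (Int.cast : ℤ → ℚ) := by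
  ext i k
  simp only [Matrix.map_apply, Matrix.mul_apply, Int.cast_sum, Int.cast_mul]

/-- **Integral symplectic frame adapted to a lattice** (Deligne's auxiliary construction, step
"choose a lattice and a polarization type"): for `ψ = auxForm M j H ξ₀ ξ` (`H` hermitian anisotropic,
`ξ₀, ξ` nonzero purely imaginary) and any `ℚ`-basis `c` of `M^{1⊕3}`, there are `n > 0`, `g > 0`,
a polarization type `δ` and a symplectic frame `F` of type `δ` for `auxForm M j H (n•ξ₀) (n•ξ) = n•ψ`
whose coordinates are `F.β = T ∘ c⁎` with `T` an integer matrix invertible over `ℤ`; thus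
`F.β⁻¹(ℤ^{2g}) = ℤ`-span of `c`. [cite: Deligne1979ShimuraVarieties, Prop. 2.3.10 (PDF p. 32)]
[cite: AdkinsWeintraub1992, Ch. 6 Thm. 2.35 (p. 361)] -/
theorem exists_symplecticFrame_integral {N : Type*} [Fintype N] [DecidableEq N]
    (c : Module.Basis N ℚ ((Fin 1 ⊕ Fin 3) → M)) (hH : Hᴴ = H) (hξ₀ : ξ₀ ≠ 0) (hξ : ξ ≠ 0)
    (hξ₀c : IsCMField.complexConj M ξ₀ = -ξ₀) (hξc : IsCMField.complexConj M ξ = -ξ)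
    (hH0 : ∀ v : Fin 3 → L, hermForm (cmConjRingHom L) H v v = 0 → v = 0) :
    ∃ (n g : ℕ) (δ : Fin g → ℕ) (F : SymplecticFrame M j H ((n : ℚ) • ξ₀) ((n : ℚ) • ξ) g δ)
      (T : Matrix (Fin g ⊕ Fin g) N ℤ) (T' : Matrix N (Fin g ⊕ Fin g) ℤ),
      0 < n ∧ 0 < g ∧ IsPolarizationType δ ∧ T * T' = 1 ∧ T' * T = 1 ∧ Fintype.card N = g + g ∧
      ∀ u, F.β u = T.map (Int.cast : ℤ → ℚ) *ᵥ c.equivFun u := by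
  classical
  obtain ⟨n, g, d, T, T', hn, hcard, hdpos, hchain, hTT', hT'T, hgram⟩ :=
    exists_integral_frobenius_frame c (auxForm M j H ξ₀ ξ)
      (auxForm_self_eq_zero j H ξ₀ ξ hH hξ₀c hξc) (auxForm_nondegenerate j H ξ₀ ξ hξ₀ hξ hH0)
  -- the coordinate isomorphism `β = T ∘ c⁎`
  let Tq : Matrix (Fin g ⊕ Fin g) N ℚ := T.map (Int.cast : ℤ → ℚ)
  let T'q : Matrix N (Fin g ⊕ Fin g) ℚ := T'.map (Int.cast : ℤ → ℚ)
  have h1 : Tq * T'q = 1 := by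
    simp only [Tq, T'q]
    rw [← map_intCast_mul, hTT', Matrix.map_one Int.cast Int.cast_zero Int.cast_one]
  have h2 : T'q * Tq = 1 := by
    simp only [Tq, T'q]
    rw [← map_intCast_mul, hT'T, Matrix.map_one Int.cast Int.cast_zero Int.cast_one]
  let θ : (N → ℚ) ≃ₗ[ℚ] (Fin g ⊕ Fin g → ℚ) :=
    LinearEquiv.ofLinear (Matrix.toLin' Tq) (Matrix.toLin' T'q)
      (by rw [← Matrix.toLin'_mul, h1, Matrix.toLin'_one])
      (by rw [← Matrix.toLin'_mul, h2, Matrix.toLin'_one])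
  have hθ : ∀ x, θ x = Tq *ᵥ x := fun x => Matrix.toLin'_apply Tq x
  let β : ((Fin 1 ⊕ Fin 3) → M) ≃ₗ[ℚ] (Fin g ⊕ Fin g → ℚ) := c.equivFun.trans θ
  have hβ : ∀ u, β u = Tq *ᵥ c.equivFun u := fun u => by
    simp only [β, LinearEquiv.trans_apply, hθ]
  have hform : typeFormOver d ℚ = (Matrix.fromBlocks 0 (Matrix.diagonal fun i => (d i : ℤ))
      (-Matrix.diagonal fun i => (d i : ℤ)) 0).map (Int.cast : ℤ → ℚ) := rfl
  refine ⟨n, g, d, ⟨β, fun v w => ?_⟩, T, T', hn, ?_, ⟨hdpos, hchain⟩, hTT', hT'T, hcard, hβ⟩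
  · rw [auxForm_smul, hgram v w, hβ, hβ, hform]
  · -- `0 < g` : `U ≠ 0`
    have hN : 0 < Fintype.card N := by
      rw [← Module.finrank_eq_card_basis c]
      exact Module.finrank_pos
    omega

end Literature.AlgebraicGeometry.ShimuraVarieties.UnitaryCanonicalModel.Aux

end
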